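import Literature.MathematicalPhysics.KineticTheory.LangevinChainSkeletonFlow
import Literature.MathematicalPhysics.KineticTheory.LangevinChainKalman
import Literature.Analysis.ODE.LinearVolterraDuality
import Mathlib.LinearAlgebra.Dual.Lemmas
import Mathlib.RingTheory.Noetherian.Basic
import HarnessLib

/-!
# The linearised pinned chain is controllable through a fine enough dyadic noise skeleton

Trunk T-KINETIC (Literature/MathematicalPhysics/KineticTheory). Provefact unit for the named fact
`CuneoEckmannHairerReyBellet2018_thm213` (`LangevinSemigroup.lean`): the SURJECTIVITY input of
the Hörmander-free local minorisation of the transition probabilities of the pinned chain near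
its equilibrium. With the notation of `LangevinChainSkeletonFlow.lean` (solution family
`S(z, x, ρ) ∈ C(I, Ω)` of the chain on `[0,1]` as a smooth function of the initial condition `z`,
the dyadic noise skeleton `x ∈ (ℝ^{2^m})²` of level `m` and the remainder noise path `ρ`):

* `pinnedChain_exists_skeleton_level_surjective` — **for some level `m`, the differential of
  `x ↦ S(0, x, 0)(1)` at `x = 0` is ONTO phase space.**

Proof. The differential `w = DS(0)(0, x, 0)` solves the constant-coefficient linear Volterra
equation `w = G_x + V_A w`, `A = DY(0)`, `G_x(τ) = (0, η_x(τ))` (the variational equation of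
`ForcedSmoothDependence.lean` at the equilibrium, where `S(0) = 0`). For the skeleton
`x = (1_{i<k}, 0)` the noise path is the RAMP `c_L 2ᵐ min(k/2ᵐ, τ) e₀` (telescoping of the tent
coefficients, `plInterp_indicator`), so by the duality formula of `LinearVolterraDuality.lean`,
`ℓ(w(1)) = c_L 2ᵐ (c ℓ(b) + ∫₀¹ min(c,t) ℓ(e^{(1-t)A} A b) dt)`, `b = (0, e₀)`, `c = k/2ᵐ`. The
reachable subspaces `R_m ⊆ Ω` increase with `m` (a level-`m` skeleton refines to a level-`m+1`
skeleton with the same piecewise-linear path, `exists_plInterp_refine`), hence stabilise (`Ω` is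
finite-dimensional, `monotone_stabilizes_iff_noetherian`); if the stable value were a proper
subspace, a nonzero functional `ℓ` would annihilate every `R_m`, so the continuous function
`c ↦ c ℓ(b) + ∫₀¹ min(c,t) ψ(t) dt` would vanish at all dyadic `c`, hence identically, forcing
`ψ ≡ 0` and `ℓ(b) = 0` (`eq_zero_of_integral_min_mul_add_eq_zero`), hence `ℓ(Aᵏ b) = 0` for
all `k` (`forall_apply_pow_eq_zero_of_exp`), hence `ℓ = 0` by Kalman's condition for the chain
(`pinnedChain_eq_zero_of_forall_pow_unitP_zero`) — a contradiction.

## References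

* N. Cuneo, J.-P. Eckmann, M. Hairer, L. Rey-Bellet, EJP 23 (2018) no. 55, §4 (controllability
  arguments for oscillator networks); E. D. Sontag, *Mathematical Control Theory* (1998), Ch. 3.
  [folklore]
-/

noncomputable section

open MeasureTheory Filter Topology Set Function unitInterval NormedSpace Finset
open scoped NNReal ContDiff BigOperators

namespace Literature.MathematicalPhysics.KineticTheory.HeatConduction

open Literature.Probability.Process Literature.Analysis.ODE OscillatorChain
open KolmogorovChentsov (dyad coe_dyad)

variable {N : ℕ}

/-! ### Tent coefficients: telescoping and refinement -/

/-- `t^m_0 = 0`. [folklore] -/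
theorem dyad_zero_right (m : ℕ) : dyad m 0 = 0 := by
  apply NNReal.coe_injective
  rw [coe_dyad]
  simp

/-- **Telescoping**: the piecewise-linear path whose first `k` increments are `1` and the others
`0` is the ramp `u ↦ 2ᵐ min(t_k, u)`. [folklore] -/
theorem plInterp_indicator (m k : ℕ) (hk : k ≤ 2 ^ m) (u : ℝ≥0) :
    plInterp m (fun i : Fin (2 ^ m) => if i.val < k then (1 : ℝ) else 0) u =
      2 ^ m * ((min (dyad m k) u : ℝ≥0) : ℝ) := by
  unfold plInterp tentCoeff
  set f : ℕ → ℝ := fun n => ((min (dyad m n) u : ℝ≥0) : ℝ) with hf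
  have h1 : ∑ i : Fin (2 ^ m), (if i.val < k then (1 : ℝ) else 0) *
      (2 ^ m * (((min (dyad m (i + 1)) u : ℝ≥0) : ℝ) - ((min (dyad m i) u : ℝ≥0) : ℝ))) =
      ∑ i ∈ range (2 ^ m), (if i < k then (1 : ℝ) else 0) * (2 ^ m * (f (i + 1) - f i)) :=
    Fin.sum_univ_eq_sum_range (fun i => (if i < k then (1 : ℝ) else 0) * (2 ^ m * (f (i + 1) - f i)))
      (2 ^ m)
  rw [h1, ← sum_range_add_sum_Ico _ hk]
  have h2 : ∑ i ∈ Ico k (2 ^ m), (if i < k then (1 : ℝ) else 0) * (2 ^ m * (f (i + 1) - f i)) = 0 := by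
    refine sum_eq_zero fun i hi => ?_
    rw [Finset.mem_Ico] at hi
    rw [if_neg (by omega), zero_mul]
  have h3 : ∑ i ∈ range k, (if i < k then (1 : ℝ) else 0) * (2 ^ m * (f (i + 1) - f i)) =
      2 ^ m * ∑ i ∈ range k, (f (i + 1) - f i) := by
    rw [mul_sum]
    refine sum_congr rfl fun i hi => ?_
    rw [Finset.mem_range] at hi
    rw [if_pos hi, one_mul]
  rw [h2, add_zero, h3, sum_range_sub]
  have hf0 : f 0 = 0 := by
    rw [hf]
    simp only [dyad_zero_right]
    simp
  rw [hf0, sub_zero]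

/-- Pairing consecutive terms of a sum over `{0, …, 2n-1}`. [folklore] -/
theorem sum_range_two_mul (g : ℕ → ℝ) (n : ℕ) :
    ∑ j ∈ range (2 * n), g j = ∑ i ∈ range n, (g (2 * i) + g (2 * i + 1)) := by
  induction n with
  | zero => simp
  | succ n ih =>
    rw [show 2 * (n + 1) = 2 * n + 1 + 1 by ring, sum_range_succ, sum_range_succ, ih, sum_range_succ]
    ring

/-- Two consecutive tent coefficients of level `m+1` add up to twice a tent coefficient of level
`m`: `λ^{m+1}_{2i} + λ^{m+1}_{2i+1} = 2 λ^m_i`. [folklore] -/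
theorem tentCoeff_succ_add (m i : ℕ) (u : ℝ≥0) :
    tentCoeff (m + 1) (2 * i) u + tentCoeff (m + 1) (2 * i + 1) u = 2 * tentCoeff m i u := by
  unfold tentCoeff
  have h0 : dyad (m + 1) (2 * i) = dyad m i := KolmogorovChentsov.dyad_succ_two_mul m i
  have h2 : dyad (m + 1) (2 * i + 1 + 1) = dyad m (i + 1) := by
    rw [show 2 * i + 1 + 1 = 2 * (i + 1) by ring]
    exact KolmogorovChentsov.dyad_succ_two_mul m (i + 1)
  rw [h0, h2, pow_succ]
  ring

/-- **Refinement**: every piecewise-linear path of level `m` is a piecewise-linear path of level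
`m + 1` (halve each increment over the two halves of its interval). [folklore] -/
theorem exists_plInterp_refine (m : ℕ) (y : Fin (2 ^ m) → ℝ) :
    ∃ y' : Fin (2 ^ (m + 1)) → ℝ, ∀ u, plInterp (m + 1) y' u = plInterp m y u := by
  classical
  -- extend `y` to `ℕ` and halve along the refinement
  set Y : ℕ → ℝ := fun n => if h : n < 2 ^ m then y ⟨n, h⟩ else 0 with hY
  refine ⟨fun j => Y (j.val / 2) / 2, fun u => ?_⟩
  unfold plInterp
  have h1 : ∑ j : Fin (2 ^ (m + 1)), Y (j.val / 2) / 2 * tentCoeff (m + 1) j u =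
      ∑ j ∈ range (2 ^ (m + 1)), Y (j / 2) / 2 * tentCoeff (m + 1) j u :=
    Fin.sum_univ_eq_sum_range (fun j => Y (j / 2) / 2 * tentCoeff (m + 1) j u) (2 ^ (m + 1))
  have h2 : ∑ i : Fin (2 ^ m), y i * tentCoeff m i u = ∑ i ∈ range (2 ^ m), Y i * tentCoeff m i u := by
    rw [← Fin.sum_univ_eq_sum_range (fun i => Y i * tentCoeff m i u) (2 ^ m)]
    refine sum_congr rfl fun i _ => ?_
    rw [hY]
    simp only [Fin.is_lt, ↓reduceDIte, Fin.eta]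
  rw [h1, h2, pow_succ', sum_range_two_mul]
  refine sum_congr rfl fun i _ => ?_
  have ha : 2 * i / 2 = i := by omega
  have hb : (2 * i + 1) / 2 = i := by omega
  rw [ha, hb]
  have ht := tentCoeff_succ_add m i u
  linear_combination (Y i / 2) * ht

/-! ### The equilibrium and the linearised operator -/

section Linear

variable {ω₂ lam β γ : ℝ}

/-- The equilibrium `0` is a zero of the drift of the pinned chain. [folklore] -/
theorem pinnedChain_drift_zero (ω₂ lam β γ : ℝ) (N : ℕ) : (pinnedChain ω₂ lam β γ).drift N 0 = 0 := by
  rw [pinnedChain_drift_apply N]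
  ext i
  · simp
  · simp only [Prod.snd_zero, Pi.zero_apply, mul_zero, sub_zero, neg_eq_zero, Prod.fst_zero]
    rw [(pinnedChain ω₂ lam β γ).dPotential_eq_closed]
    simp [pinnedChain_deriv_U, pinnedChain_deriv_V]

/-- The Nemytskii operator of the drift at the zero curve vanishes. [folklore] -/
theorem nemytskii_drift_zero (ω₂ lam β γ : ℝ) (N : ℕ) :
    nemytskii ((pinnedChain ω₂ lam β γ).drift N) (0 : C(I, PhaseSpace N)) = 0 := by
  have hc : Continuous ((pinnedChain ω₂ lam β γ).drift N ∘ ((0 : C(I, PhaseSpace N)) : I → PhaseSpace N)) :=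
    (pinnedChain_contDiff_drift ω₂ lam β γ N (n := 0)).continuous.comp (map_continuous _)
  refine ContinuousMap.ext fun τ => ?_
  rw [nemytskii_apply hc, ContinuousMap.zero_apply, pinnedChain_drift_zero]

/-- The Nemytskii operator of the derivative of the drift at the zero curve is the constant curve
`A = DY(0)`. [folklore] -/
theorem nemytskii_fderiv_drift_zero (ω₂ lam β γ : ℝ) (N : ℕ) :
    nemytskii (fderiv ℝ ((pinnedChain ω₂ lam β γ).drift N)) (0 : C(I, PhaseSpace N)) =
      ContinuousMap.const I (fderiv ℝ ((pinnedChain ω₂ lam β γ).drift N) 0) := by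
  have hc : Continuous (fderiv ℝ ((pinnedChain ω₂ lam β γ).drift N) ∘
      ((0 : C(I, PhaseSpace N)) : I → PhaseSpace N)) :=
    ((pinnedChain_contDiff_drift ω₂ lam β γ N (n := 1)).continuous_fderiv one_ne_zero).comp
      (map_continuous _)
  refine ContinuousMap.ext fun τ => ?_
  rw [nemytskii_apply hc, ContinuousMap.zero_apply, ContinuousMap.const_apply]

end Linear

/-! ### The variational equation along a skeleton direction, and its dual value -/

section Variational

variable {ω₂ lam β γ : ℝ} (hω : 0 < ω₂) (hl : 0 ≤ lam) (hβ : 0 ≤ β) (hγ : 0 ≤ γ) (hN : 0 < N)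
  (m : ℕ) (cL cR : ℝ)
  (η : PairSkeleton m → C(I, Fin N → ℝ) → ℝ → Fin N → ℝ)
  (hη : ∀ (x : PairSkeleton m) (ρ : C(I, Fin N → ℝ)) (t : ℝ) (i : Fin N),
    η x ρ t i = ρ (projIcc 0 1 zero_le_one t) i +
      ((if i.val = 0 then cL else 0) * plInterp m x.1 t.toNNReal +
        (if i.val = N - 1 then cR else 0) * plInterp m x.2 t.toNNReal))
  (g : PhaseSpace N × PairSkeleton m × C(I, Fin N → ℝ) →L[ℝ] C(I, PhaseSpace N))
  (hg : ∀ (p : PhaseSpace N × PairSkeleton m × C(I, Fin N → ℝ)) (τ : I),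
    g p τ = p.1 + ((0 : Fin N → ℝ), η p.2.1 p.2.2 τ))
  {S : PhaseSpace N × PairSkeleton m × C(I, Fin N → ℝ) → C(I, PhaseSpace N)}
  (hS : ∀ p, forcedRobbinMap ((pinnedChain ω₂ lam β γ).drift N) g (p, S p) = 0)
  (huniq : ∀ p α, forcedRobbinMap ((pinnedChain ω₂ lam β γ).drift N) g (p, α) = 0 → α = S p)
include hη hg hS huniq

omit hη hg hS in
/-- The solution at the zero parameter is the zero curve (uniqueness). [folklore] -/
theorem skelSol_zero_of_unique : S 0 = 0 := by
  refine (huniq 0 0 ?_).symm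
  show g (0 : PhaseSpace N × PairSkeleton m × C(I, Fin N → ℝ)) +
    primitiveCLM (nemytskii ((pinnedChain ω₂ lam β γ).drift N) (0 : C(I, PhaseSpace N))) -
      (0 : C(I, PhaseSpace N)) = 0
  rw [map_zero, nemytskii_drift_zero, map_zero, sub_zero, add_zero]

omit hη hg in
/-- **The variational equation along a parameter direction is a constant-coefficient linear
Volterra equation**: `w = DS(0)δ` satisfies `w = g δ + V_A w`, `A = DY(0)`. [folklore] -/
theorem fderiv_skelSol_zero_eq (δ : PhaseSpace N × PairSkeleton m × C(I, Fin N → ℝ)) :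
    fderiv ℝ S 0 δ = g δ + volterraCLM (ContinuousMap.const I (fderiv ℝ ((pinnedChain ω₂ lam β γ).drift N) 0))
      (fderiv ℝ S 0 δ) := by
  have hY : ContDiff ℝ 1 ((pinnedChain ω₂ lam β γ).drift N) := pinnedChain_contDiff_drift ω₂ lam β γ N
  have h := fderiv_forcedSolution_family_eq hY g.contDiff le_rfl hS huniq 0 δ
  rw [skelSol_zero_of_unique m g huniq, nemytskii_fderiv_drift_zero, ContinuousLinearMap.fderiv] at h
  exact h

include hN in
/-- **The dual value of the differential along an indicator skeleton.** For the skeleton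
`x = (1_{i<k}, 0)` of level `m` (`k ≤ 2ᵐ`) and every continuous linear functional `ℓ`,
`ℓ(DS(0)(0, x, 0)(1)) = c_L 2ᵐ (c ℓ(b) + ∫₀¹ min(c,t) ℓ(e^{(1-t)A} A b) dt)` with `b = (0, e₀)`,
`c = k/2ᵐ` (the forcing is the ramp `(c_L 2ᵐ min(c, τ)) • b`, `plInterp_indicator`, and the
duality formula `volterra_const_duality_ramp` applies). [folklore] -/
theorem dual_fderiv_skelSol_indicator (ℓ : PhaseSpace N →L[ℝ] ℝ) (k : ℕ) (hk : k ≤ 2 ^ m) :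
    ℓ (fderiv ℝ S 0 ((0 : PhaseSpace N), ((fun i : Fin (2 ^ m) => if i.val < k then (1 : ℝ) else 0),
        (0 : Fin (2 ^ m) → ℝ)), (0 : C(I, Fin N → ℝ))) 1) =
      cL * 2 ^ m * ((k : ℝ) / 2 ^ m * ℓ (unitP ⟨0, hN⟩) +
        ∫ t in (0 : ℝ)..1, min ((k : ℝ) / 2 ^ m) t *
          ℓ (exp ((1 - t) • fderiv ℝ ((pinnedChain ω₂ lam β γ).drift N) 0)
            (fderiv ℝ ((pinnedChain ω₂ lam β γ).drift N) 0 (unitP ⟨0, hN⟩)))) := by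
  set A := fderiv ℝ ((pinnedChain ω₂ lam β γ).drift N) 0 with hA
  set xk : Fin (2 ^ m) → ℝ := fun i => if i.val < k then (1 : ℝ) else 0 with hxk
  set δ : PhaseSpace N × PairSkeleton m × C(I, Fin N → ℝ) := (0, (xk, 0), 0) with hδ
  have hw := fderiv_skelSol_zero_eq m g hS huniq δ
  -- the forcing is a ramp
  have hc : (k : ℝ) / 2 ^ m ∈ Icc (0 : ℝ) 1 := by
    refine ⟨by positivity, ?_⟩
    rw [div_le_one (by positivity)]
    exact_mod_cast hk
  have hG : ∀ τ : I, g δ τ = (cL * 2 ^ m * min ((k : ℝ) / 2 ^ m) (τ : ℝ)) • unitP ⟨0, hN⟩ := by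
    intro τ
    rw [hg]
    simp only [hδ, zero_add]
    rw [unitP_eq, Prod.smul_mk, smul_zero]
    congr 1
    funext i
    rw [hη, ContinuousMap.zero_apply, Pi.zero_apply, zero_add, Pi.smul_apply, Pi.single_apply,
      smul_eq_mul]
    have hpl0 : plInterp m (0 : Fin (2 ^ m) → ℝ) ((τ : ℝ).toNNReal) = 0 := by simp [plInterp]
    have hplk : plInterp m xk ((τ : ℝ).toNNReal) = 2 ^ m * min ((k : ℝ) / 2 ^ m) (τ : ℝ) := by
      rw [hxk, plInterp_indicator m k hk, NNReal.coe_min, coe_dyad, Real.coe_toNNReal _ τ.2.1]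
    simp only [hpl0, mul_zero, add_zero, hplk]
    by_cases hi : i = ⟨0, hN⟩
    · subst hi
      simp [mul_assoc]
    · have hi' : i.val ≠ 0 := fun e => hi (Fin.ext e)
      simp [hi, hi']
  rw [volterra_const_duality_ramp A ℓ (unitP ⟨0, hN⟩) hc hG hw]

end Variational

/-! ### Vanishing of the dual functional -/

/-- **If a functional annihilates all the dual values then it vanishes**: if
`c_L 2ᵐ (k/2ᵐ ℓ(b) + ∫₀¹ min(k/2ᵐ, t) ℓ(e^{(1-t)A} A b) dt) = 0` for all levels `m` and all
`k ≤ 2ᵐ` (`c_L ≠ 0`), then `ℓ = 0`: the continuous function of `c` vanishes at dyadic `c`, hence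
on `[0,1]`, so `ℓ(e^{sA} A b) = 0` on `[0,1]` and `ℓ(b) = 0`, so `ℓ(Aᵏ b) = 0` for all `k`, so
`ℓ = 0` by Kalman's condition for the pinned chain. [folklore] -/
theorem pinnedChain_dual_eq_zero_of_forall_level {ω₂ lam β γ : ℝ} (hN : 0 < N) {cL : ℝ}
    (hcL : cL ≠ 0) (ℓ : PhaseSpace N →L[ℝ] ℝ)
    (h : ∀ m k : ℕ, k ≤ 2 ^ m →
      cL * 2 ^ m * ((k : ℝ) / 2 ^ m * ℓ (unitP ⟨0, hN⟩) +
        ∫ t in (0 : ℝ)..1, min ((k : ℝ) / 2 ^ m) t *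
          ℓ (exp ((1 - t) • fderiv ℝ ((pinnedChain ω₂ lam β γ).drift N) 0)
            (fderiv ℝ ((pinnedChain ω₂ lam β γ).drift N) 0 (unitP ⟨0, hN⟩)))) = 0) :
    ℓ = 0 := by
  set A := fderiv ℝ ((pinnedChain ω₂ lam β γ).drift N) 0 with hA
  set b : PhaseSpace N := unitP ⟨0, hN⟩ with hb
  set ψ : ℝ → ℝ := fun t => ℓ (exp ((1 - t) • A) (A b)) with hψ
  have hψc : Continuous ψ := by
    have h1 : Continuous fun t : ℝ => exp ((1 - t) • A) :=
      (differentiable_exp_smul_const ℝ A).continuous.comp (continuous_const.sub continuous_id)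
    exact ℓ.continuous.comp (h1.clm_apply continuous_const)
  set Φ : ℝ → ℝ := fun c => (∫ t in (0 : ℝ)..1, min c t * ψ t) + c * ℓ b with hΦ
  -- `Φ` vanishes at dyadics
  have hΦdy : ∀ m k : ℕ, k ≤ 2 ^ m → Φ ((k : ℝ) / 2 ^ m) = 0 := by
    intro m k hk
    have h1 := h m k hk
    have hne : cL * 2 ^ m ≠ 0 := mul_ne_zero hcL (by positivity)
    have h2 := (mul_eq_zero.1 h1).resolve_left hne
    rw [hΦ]
    simp only
    linarith
  -- `Φ` is continuous
  have hΦc : Continuous Φ := by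
    have h1 : Continuous fun c : ℝ => ∫ t in (0 : ℝ)..1, min c t * ψ t := by
      refine intervalIntegral.continuous_parametric_intervalIntegral_of_continuous' ?_ 0 1
      exact (continuous_fst.min continuous_snd).mul (hψc.comp continuous_snd)
    exact h1.add (continuous_id.mul continuous_const)
  have hΦ0 : ∀ c ∈ Icc (0 : ℝ) 1, Φ c = 0 := forall_Icc_of_forall_dyadic hΦc.continuousOn hΦdy
  -- hence `ψ = 0` on `[0,1]` and `ℓ b = 0`
  obtain ⟨hψ0, hb0⟩ := eq_zero_of_integral_min_mul_add_eq_zero hψc hΦ0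
  -- hence `ℓ (e^{sA} (A b)) = 0` for `s ∈ [0,1]`
  have hexp : ∀ s ∈ Icc (0 : ℝ) 1, ℓ (exp (s • A) (A b)) = 0 := by
    intro s hs
    have := hψ0 (1 - s) ⟨by linarith [hs.2], by linarith [hs.1]⟩
    simpa [hψ] using this
  have hpow : ∀ k : ℕ, ℓ ((A ^ k) (A b)) = 0 := forall_apply_pow_eq_zero_of_exp ℓ A (A b) hexp
  have hall : ∀ k : ℕ, ℓ ((A ^ k) b) = 0 := by
    intro k
    cases k with
    | zero => simpa using hb0
    | succ k =>
      rw [pow_succ]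
      exact hpow k
  -- Kalman
  have hlin := pinnedChain_eq_zero_of_forall_pow_unitP_zero ω₂ lam β γ hN (ℓ : PhaseSpace N →ₗ[ℝ] ℝ) hall
  exact ContinuousLinearMap.coe_injective hlin

/-! ### Surjectivity at some level -/

/-- **The linearised pinned chain is controllable through a fine enough noise skeleton.** For the
pinned chain (`ω₂ > 0`, `lam, β, γ ≥ 0`, `N ≥ 1`) and a left noise amplitude `c_L ≠ 0` there is a
level `m` such that, for the solution family `S` of level `m` (characterised by the parametric
Robbin equation of the forcing `g(z,x,ρ) = z + (0, η_{x,ρ})`), the linear map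
`x ↦ DS(0)(0, x, 0)(1)` of the skeleton space `(ℝ^{2^m})²` to phase space is ONTO.
[folklore] -/
theorem pinnedChain_exists_skeleton_level_surjective {ω₂ lam β γ : ℝ} (hω : 0 < ω₂) (hl : 0 ≤ lam)
    (hβ : 0 ≤ β) (hγ : 0 ≤ γ) (hN : 0 < N) {cL : ℝ} (hcL : cL ≠ 0) (cR : ℝ) :
    ∃ m : ℕ, ∀ (η : PairSkeleton m → C(I, Fin N → ℝ) → ℝ → Fin N → ℝ)
      (_hη : ∀ (x : PairSkeleton m) (ρ : C(I, Fin N → ℝ)) (t : ℝ) (i : Fin N),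
        η x ρ t i = ρ (projIcc 0 1 zero_le_one t) i +
          ((if i.val = 0 then cL else 0) * plInterp m x.1 t.toNNReal +
            (if i.val = N - 1 then cR else 0) * plInterp m x.2 t.toNNReal))
      (g : PhaseSpace N × PairSkeleton m × C(I, Fin N → ℝ) →L[ℝ] C(I, PhaseSpace N))
      (_hg : ∀ (p : PhaseSpace N × PairSkeleton m × C(I, Fin N → ℝ)) (τ : I),
        g p τ = p.1 + ((0 : Fin N → ℝ), η p.2.1 p.2.2 τ))
      (S : PhaseSpace N × PairSkeleton m × C(I, Fin N → ℝ) → C(I, PhaseSpace N))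
      (_hS : ∀ p, forcedRobbinMap ((pinnedChain ω₂ lam β γ).drift N) g (p, S p) = 0)
      (_huniq : ∀ p α, forcedRobbinMap ((pinnedChain ω₂ lam β γ).drift N) g (p, α) = 0 → α = S p),
      LinearMap.range (((ContinuousMap.evalCLM ℝ (1 : I)).comp ((fderiv ℝ S 0).comp
        ((ContinuousLinearMap.inr ℝ (PhaseSpace N) (PairSkeleton m × C(I, Fin N → ℝ))).comp
          (ContinuousLinearMap.inl ℝ (PairSkeleton m) C(I, Fin N → ℝ))))) :
            PairSkeleton m →ₗ[ℝ] PhaseSpace N) = ⊤ := by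
  classical
  set Y := (pinnedChain ω₂ lam β γ).drift N with hY
  -- canonical objects at every level
  let ηc : (m : ℕ) → PairSkeleton m → C(I, Fin N → ℝ) → ℝ → Fin N → ℝ := fun m x ρ t i =>
    ρ (projIcc 0 1 zero_le_one t) i +
      ((if i.val = 0 then cL else 0) * plInterp m x.1 t.toNNReal +
        (if i.val = N - 1 then cR else 0) * plInterp m x.2 t.toNNReal)
  have hηc : ∀ (m : ℕ) (x : PairSkeleton m) (ρ : C(I, Fin N → ℝ)) (t : ℝ) (i : Fin N),
      ηc m x ρ t i = ρ (projIcc 0 1 zero_le_one t) i +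
        ((if i.val = 0 then cL else 0) * plInterp m x.1 t.toNNReal +
          (if i.val = N - 1 then cR else 0) * plInterp m x.2 t.toNNReal) := fun _ _ _ _ _ => rfl
  have hgex : ∀ m : ℕ, ∃ g : PhaseSpace N × PairSkeleton m × C(I, Fin N → ℝ) →L[ℝ] C(I, PhaseSpace N),
      ∀ (p : PhaseSpace N × PairSkeleton m × C(I, Fin N → ℝ)) (τ : I),
        g p τ = p.1 + ((0 : Fin N → ℝ), ηc m p.2.1 p.2.2 τ) :=
    fun m => exists_skelForcingCLM m cL cR (ηc m) (hηc m)
  choose gc hgc using hgex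
  have hSex : ∀ m : ℕ, ∃ S : PhaseSpace N × PairSkeleton m × C(I, Fin N → ℝ) → C(I, PhaseSpace N),
      (∀ p τ, S p τ = (pinnedChain ω₂ lam β γ).chainFlow N p.1 (ηc m p.2.1 p.2.2) τ) ∧
      (∀ p, forcedRobbinMap Y (gc m) (p, S p) = 0) ∧
      (∀ p α, forcedRobbinMap Y (gc m) (p, α) = 0 → α = S p) ∧ ContDiff ℝ 1 S :=
    fun m => exists_skelSol hω hl hβ hγ m cL cR (ηc m) (hηc m) (gc m) (hgc m) 1 le_rfl
  choose Sc _hSapply hSc huniqc _hdiffc using hSex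
  -- the inclusion of the skeleton and the reachability maps
  let ι : (m : ℕ) → PairSkeleton m →L[ℝ] PhaseSpace N × PairSkeleton m × C(I, Fin N → ℝ) := fun m =>
    (ContinuousLinearMap.inr ℝ (PhaseSpace N) (PairSkeleton m × C(I, Fin N → ℝ))).comp
      (ContinuousLinearMap.inl ℝ (PairSkeleton m) C(I, Fin N → ℝ))
  have hι : ∀ m (x : PairSkeleton m), ι m x = ((0 : PhaseSpace N), x, (0 : C(I, Fin N → ℝ))) :=
    fun m x => rfl
  let Tc : (m : ℕ) → PairSkeleton m →ₗ[ℝ] PhaseSpace N := fun m =>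
    (((ContinuousMap.evalCLM ℝ (1 : I)).comp ((fderiv ℝ (Sc m) 0).comp (ι m))) :
      PairSkeleton m →ₗ[ℝ] PhaseSpace N)
  have hTc : ∀ m (x : PairSkeleton m), Tc m x = fderiv ℝ (Sc m) 0 ((0 : PhaseSpace N), x, 0) 1 :=
    fun m x => rfl
  let R : ℕ → Submodule ℝ (PhaseSpace N) := fun m => LinearMap.range (Tc m)
  -- monotonicity by refinement
  have hmono : Monotone R := by
    refine monotone_nat_of_le_succ fun m => ?_
    rintro v ⟨x, rfl⟩
    obtain ⟨y₁, hy₁⟩ := exists_plInterp_refine m x.1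
    obtain ⟨y₂, hy₂⟩ := exists_plInterp_refine m x.2
    refine ⟨(y₁, y₂), ?_⟩
    rw [hTc, hTc]
    -- both differentials solve the same Volterra equation
    have hw := fderiv_skelSol_zero_eq m (gc m) (hSc m) (huniqc m) ((0 : PhaseSpace N), x, 0)
    have hw' := fderiv_skelSol_zero_eq (m + 1) (gc (m + 1)) (hSc (m + 1)) (huniqc (m + 1))
      ((0 : PhaseSpace N), (y₁, y₂), 0)
    have hGeq : gc (m + 1) ((0 : PhaseSpace N), (y₁, y₂), 0) = gc m ((0 : PhaseSpace N), x, 0) := by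
      refine ContinuousMap.ext fun τ => ?_
      rw [hgc, hgc]
      simp only
      congr 2
      funext i
      rw [hηc, hηc]
      simp only [ContinuousMap.zero_apply, hy₁, hy₂]
    rw [hGeq] at hw'
    have := volterra_unique _ hw' hw
    rw [this]
  -- stabilisation
  obtain ⟨M, hM⟩ := (monotone_stabilizes_iff_noetherian.2 inferInstance) ⟨R, hmono⟩
  have hM' : ∀ m, M ≤ m → R M = R m := fun m hm => hM m hm
  -- the stable value is everything
  have htop : R M = ⊤ := by
    by_contra hne
    obtain ⟨f, hf0, hfR⟩ := Submodule.exists_dual_map_eq_bot_of_lt_top (lt_top_iff_ne_top.2 hne)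
      inferInstance
    have hkill : ∀ (m : ℕ) (x : PairSkeleton m), f (Tc m x) = 0 := by
      intro m x
      have hmem : Tc m x ∈ R M := by
        rcases le_total m M with hle | hle
        · exact hmono hle ⟨x, rfl⟩
        · rw [hM' m hle]; exact ⟨x, rfl⟩
      have h1 : f (Tc m x) ∈ (R M).map f := Submodule.mem_map_of_mem hmem
      rw [hfR] at h1
      simpa using h1
    let ℓ : PhaseSpace N →L[ℝ] ℝ := LinearMap.toContinuousLinearMap f
    have hℓf : ∀ v, ℓ v = f v := fun v => rfl
    have hℓ : ℓ = 0 := by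
      refine pinnedChain_dual_eq_zero_of_forall_level (ω₂ := ω₂) (lam := lam) (β := β) (γ := γ)
        hN hcL ℓ fun m k hk => ?_
      rw [← dual_fderiv_skelSol_indicator hN m cL cR (ηc m) (hηc m) (gc m) (hgc m) (hSc m) (huniqc m)
        ℓ k hk, hℓf, ← hTc]
      exact hkill m _
    apply hf0
    refine LinearMap.ext fun v => ?_
    rw [← hℓf, hℓ]
    rfl
  -- transfer to the given objects of level `M`
  refine ⟨M, fun η hη g hg S hS huniq => ?_⟩
  have hηeq : η = ηc M := by
    funext x ρ t i
    rw [hη, hηc]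
  have hgeq : g = gc M := by
    refine ContinuousLinearMap.ext fun p => ContinuousMap.ext fun τ => ?_
    rw [hg, hgc, hηeq]
  have hSeq : S = Sc M := by
    funext p
    refine huniqc M p (S p) ?_
    rw [← hgeq]
    exact hS p
  rw [hSeq]
  exact htop

end Literature.MathematicalPhysics.KineticTheory.HeatConduction
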